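import Summits.CriticalPhenomena.SAWScalingLimit.Theses.SAWRenewalTightness
import Summits.CriticalPhenomena.SAWScalingLimit.Theses.SAWParafermion
import Summits.CriticalPhenomena.SAWScalingLimit.Theses.SAWLaplacianWalk
import Literature.Probability.RandomPlanarGeometry.LoewnerCotArgExit
import Literature.Probability.RandomPlanarGeometry.SLEKappaRhoSchrammObservable
import Literature.Probability.RandomPlanarGeometry.DrivingFunctionMeasurable
import Literature.Probability.RandomPlanarGeometry.SLELawOfDrivingProcessLocal
import Literature.Probability.RandomPlanarGeometry.ObservableDrivingMartingales
import Literature.Probability.RandomPlanarGeometry.JordanIndex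
import Literature.Probability.LatticeModels.SRWKilledWalkFunctionals
import HarnessLib

/-!
# Line `room-entropy-wright-fisher` — skeleton for crux `SubseqIdentification` (stmt-CriticalPhenomena-0783)

(Lead reshape r1, prover-line-stmt-CriticalPhenomena-0783-0, 2026-08-16: stub signatures spelled out verbatim
over the vocabulary, which is being landed as `Theorems/SAWRenewalTightnessRoomEntropyDefs.lean`; statements,
stub set and composition unchanged.)

Crux (route `SAWRenewalTightness`, rank 5; shared verbatim by `SAWParafermion` (r3),
`SAWLeftRightFKG`, `SAWAsymptoticMorera`): every probability subsequential weak limit `μ` of the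
critical `δℤ²` SAW laws in a Dobrushin domain `(D; a, b)` along meshes `s n → 0⁺` is the chordal
SLE(8/3) law of `D`.

Idea (card `Ideas/room-entropy-wright-fisher.md`, triage r1-1/2/3: pass ×3). THE ROOM OF A POINT.
For an interior point `z` the *room* left by the polymer is the diagonal Green function of an
independent simple random walk killed by the walk: on the lattice the **room deficit**
`(π/2)·[G_{Ω_δ}(z,z) − G_{Ω_δ∖γ[0,n]}(z,z)]` (a DIFFERENCE of two killed Green functions at the
same site: the potential-kernel constant `(2/π) log δ⁻¹ + k₀` cancels, dimension 0, monotone in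
the past, no normalisation point) is the lattice avatar of the log-conformal-radius loss
`log ψ_t(w)` (`Loewner.derivRatio`, Rohde–Schramm's ratio), and the exact Doob martingale
`n ↦ E_δ[terminal room ∣ γ[0,n]]` is, by the configurational domain-Markov property of the
weight `x_c^{|γ|}`, the expected-terminal-room one-point function of the slit domain. The κ = 8/3
prediction for its profile is closed-form and entropy-shaped — expected log-conformal-radius loss
seen from `w` at conformal angle `θ` equals `Λ(θ) = 3·H(sin²(θ/2))` (`H` = binary entropy in
nats; `Λ` is the unique bounded solution of the Feynman–Kac ODE
`(κ/2) sin θ Λ'' + (κ−4) cos θ Λ' = −4 sin θ`, `Λ(0) = Λ(π) = 0`, at `κ = 8/3`; its siblings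
`Λ₂ = 2 sin²θ` (LERW, determinantal, exact on every finite graph) and `Λ₄ = θ(π−θ)` (GFF level
line) are solved) — so that `N_t(w) := log ψ_t(w) + 3·H(S_t(w))` (`S_t` = Schramm's observable
`Loewner.schrammObs = cos²(arg z_t/2)`, and `H(cos²) = H(sin²)`: ORIENTATION-FREE) is a local
martingale exactly at `κ = 8/3` (drift `∝ (3κ − 8)`, checked numerically by all three triagers and
again in this seat, `checks/drift_check.py`).

Shape of the line (four registered stubs, composition `SubseqIdentification_of` sorry-free over
them and over the shared route item `SAWLaplacianWalk.LimitsDescribable` taken BY NAME as a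
hypothesis):

* `stub_roomLawSlit : RoomLawSlit` — THE BET (lattice, open, hardest): in `P_δ`-probability,
  uniformly along the past until it enters `B(z, r)`, the expected terminal room given the past
  equals the current room minus `(2/π)·Λ(θ*_δ)`, where `θ*_δ = π ×` the discrete harmonic measure,
  from `z_δ` in the slit graph, of [the side darts of the past on the `arc 1` side + the exits
  through the discrete `arc 1`] — every ingredient a simple-random-walk functional
  (`SRW.killedGreen`) of the same graph. In-probability over SAW-typical pasts (triage r1-2/3:
  the all-pasts form with fixed-scale guards is killed by one-site gates sealing a macroscopic
  pocket around `z` whose wall mixes the two sides — the prediction is `> 0`, the deficit `≈ 0`).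
* `stub_roomMartingaleLimit : RoomLawSlit → RoomMartingaleLimit` (XL, known technology in three
  layers): for a subsequential limit `μ` carried by Loewner-describable curves from `a`, the
  stopped continuum observables `N^{w,m}` are martingales for a filtration to which the driving
  process is adapted. Layers: (i) RW potential theory on rough lattice slit domains — Green
  deficit → log conformal-radius ratio, side harmonic measure → `arg z_t/π`
  (Kozdron–Lawler 2005 §2–3, Lawler–Limic 2010 §6.2–6.3, LSW04 §2; THIS is where the square
  symmetry of `ℤ² ⊂ ℂ` is spent: the isotropic invariance principle of the SRW);
  (ii) Carathéodory/capacity bookkeeping along a Skorokhod coupling (KS17 Thm 1.5/Cor 1.7,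
  LSW04 §3.3–3.4); (iii) discrete optional stopping at the entrance of `B(z,r)` (the compensated
  martingale is then bounded by `log(C/r) + 3 log 2` uniformly in δ — no arm estimate needed for
  the transfer) and bounded convergence.
* `stub_roomEntropyCharacterisesSLE : RoomEntropyCharacterisesSLE` (L, provable now): two
  far-field channels — order `1/R` at `θ₀ ≠ π/2` makes `W` a local martingale, order `1/R²` at
  `θ₀ = π/2` makes `−(3/2)W² + 4t`, i.e. `W² − (8/3)t`, one — then the tree's
  `isSLELaw_of_isLocalMartingale_driving_of_lt_four` (PROVED, `8/3 < 4`): no named fact.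
* hypothesis `LimitsDescribable` (stmt-CriticalPhenomena-4481, shared open input of every
  martingale line: KS regularity of subsequential limits).

Disproof used (`Cruxes/SubseqIdentification/Disproof.lean`, cdisprove cycle 1 v4, NO KILL):
`subseqIdentification_false_without_endpointLimits/_fstLimit/_sndLimit` — honoured: every stub
about SAW laws keeps `IsEndpointApprox` whole (`RoomLawSlit`, `RoomMartingaleLimit`); the endpoint
limit `tendsto_fst` is USED in `stub_roomMartingaleLimit` (the lattice past starts at `a_δ → a`,
which is what closes the gap between the slit and `∂D` seen by the random walk, and what makes
the limit curve start at `φ(0)`), `tendsto_snd` in the identification of `b` with `φ(∞)`;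
`_false_without_oneSided/_meshToZero` — honoured: all lattice clauses are `∀ᶠ δ in 𝓝[>] 0`;
§1c (`IsProbabilityMeasure μ` derivable) — carried verbatim, harmless; §3
`ae_endpoints_of_hyps`, `ae_range_subset_closure_of_hyps` — available to the prover of
`stub_roomMartingaleLimit`; §4.7 (embedding sensitivity) — answered at layer (i) of
`stub_roomMartingaleLimit` and nowhere else. No landed Negative lemma exists for this crux
(`Theorems/SubseqIdentification/` has no `Negative/`); negatives index (stmt-0772 all-δ `Tight`,
stmt-5420 unpinned boundary-root observable): not restated — no boundary normalisation point, no
all-δ clause.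
-/

noncomputable section

open MeasureTheory Filter Topology Set
open scoped NNReal ENNReal Classical BigOperators
open Literature.Probability.LatticeModels
open Literature.Probability.RandomPlanarGeometry
open UpperHalfPlane (upperHalfPlaneSet)
open Summit.CriticalPhenomena.SAWScalingLimit.Theses.SAWRenewalTightness (SubseqIdentification)
open Summit.CriticalPhenomena.SAWScalingLimit.Theses.SAWLaplacianWalk (LimitsDescribable)

namespace Summit.CriticalPhenomena.SAWScalingLimit.Cruxes.SubseqIdentification.RoomEntropyWrightFisher

/-! ## Continuum vocabulary (statements only) -/

/-- The κ = 8/3 **room profile** `Λ(θ) = 3·H(sin²(θ/2))`, `H` = binary entropy in nats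
(`Real.binEntropy`): expected log-conformal-radius loss of chordal SLE(8/3) seen from a point at
conformal angle `θ`; `Λ(0) = Λ(π) = 0`, `Λ(π/2) = 3 log 2`, `Λ(π − θ) = Λ(θ)`. -/
def roomProfile (θ : ℝ) : ℝ :=
  3 * Real.binEntropy (Real.sin (θ / 2) ^ 2)

/-- The **room–entropy observable** along the centred Loewner flow of a driving function `W`
seen from `w ∈ ℍ`: `N_t(w) = log ψ_t(w) + 3·H(S_t(w))`, `ψ_t` = Rohde–Schramm's ratio
`Loewner.derivRatio` (`log ψ_t` = loss of log conformal radius of `ℍ ∖ K_t` at `w`), `S_t` =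
Schramm's observable `Loewner.schrammObs = (1 + cos arg z_t)/2`; since `H(p) = H(1 − p)`,
`3·H(S_t) = Λ(arg z_t)`. Junk after the swallowing time (never reached below). -/
def roomObs (W : ℝ≥0 → ℝ) (w : ℂ) (t : ℝ≥0) : ℝ :=
  Real.log (Loewner.derivRatio W w t) + 3 * Real.binEntropy (Loewner.schrammObs W w t)

/-- The **room stop** `τ^{w,m}`: the first time `Im z_t(w) ≤ Im w/(m+1)`, capped at `m + 1`
(the union with `{m+1}` makes the infimum a minimum; before `τ^{w,m}` one has
`0 ≤ log ψ_t ≤ log(m+1) + 2(m+1)³/(Im w)²`, so the stopped observable is bounded, and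
`dist(w, K_t ∪ ℝ) ≥ Im w/(2ψ_t)` by Koebe, so the hull stays a definite distance from `w`). -/
def roomStop (W : ℝ≥0 → ℝ) (w : ℂ) (m : ℕ) : ℝ≥0 :=
  sInf ({t : ℝ≥0 | (Loewner.centredMap W t w).im ≤ w.im / ((m : ℝ) + 1)} ∪ {(m : ℝ≥0) + 1})

/-- The stopped room–entropy observable `N^{w,m}_t = N_{t ∧ τ^{w,m}}(w)`. -/
def roomObsStopped (W : ℝ≥0 → ℝ) (w : ℂ) (m : ℕ) (t : ℝ≥0) : ℝ :=
  roomObs W w (min t (roomStop W w m))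

/-! ## Lattice vocabulary (statements only): slit graphs, rooms, side darts -/

/-- The four unit steps of `ℤ²`. -/
def dirs : Finset (Site 2) := {![1, 0], ![0, 1], ![-1, 0], ![0, -1]}

/-- Anticlockwise quarter turn of `ℤ²`. -/
def rotL (d : Site 2) : Site 2 := ![-(d 1), d 0]

/-- Clockwise quarter turn of `ℤ²`. -/
def rotR (d : Site 2) : Site 2 := ![d 1, -(d 0)]

/-- The **slit graph** `Ω_δ ∖ S`: the discrete domain graph with the vertices of `S` isolated
(the pattern of `SRW.exitAfterAvoiding_of_adj_iff`). The simple random walk run along its edges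
is killed at its first step onto `S`, out of `Ω_δ`, or along a deleted boundary edge. -/
def slitGraph (Ω : Set ℂ) (δ : ℝ) (S : Set (Site 2)) : SimpleGraph (Site 2) :=
  SimpleGraph.fromRel fun x y => (discreteDomainGraph Ω δ).Adj x y ∧ x ∉ S ∧ y ∉ S

/-- The **room** of the site `z` in `Ω_δ ∖ S`: the diagonal killed Green function
`G_{Ω_δ∖S}(z, z)` = expected number of visits to `z` (time `0` included) of the simple random
walk from `z` before it is killed (`SRW.killedGreen`). -/
def roomAt (Ω : Set ℂ) (δ : ℝ) (S : Set (Site 2)) (z : Site 2) : ℝ :=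
  SRW.killedGreen (slitGraph Ω δ S) z z

/-- The vertex set of a walk. -/
def verts {G : SimpleGraph (Site 2)} {u w : Site 2} (η : G.Walk u w) : Set (Site 2) :=
  {v | v ∈ η.support}

/-- **Side darts of a lattice path.** For `0 < k < |η|`, incoming step `i = η_k − η_{k−1}` and
outgoing step `o = η_{k+1} − η_k`, the free neighbour `η_k + d ∉ η` lies on the `ρ`-side of `η`
at `η_k` (`ρ = rotL`: left of the direction of travel; `ρ = rotR`: right) iff either the path goes
straight (`o = i`) and `d = ρ i`, or the path turns AWAY from the `ρ`-side (`o = −ρ i`), in which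
case both free neighbours are on the `ρ`-side. Darts at the two endpoints are not side darts
(their harmonic measure from an interior point vanishes in the limit: Beurling at the tip, the
closing gap `δ·a_δ → a ∈ ∂D` at the start). -/
def IsSideDart {G : SimpleGraph (Site 2)} {u w : Site 2} (ρ : Site 2 → Site 2) (η : G.Walk u w)
    (k : ℕ) (d : Site 2) : Prop :=
  0 < k ∧ k < η.length ∧ η.getVert k + d ∉ η.support ∧
    ((η.getVert (k + 1) - η.getVert k = η.getVert k - η.getVert (k - 1) ∧
        d = ρ (η.getVert k - η.getVert (k - 1))) ∨
      η.getVert (k + 1) - η.getVert k = -ρ (η.getVert k - η.getVert (k - 1)))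

/-- `4 ×` the harmonic measure, from `z` in the slit graph `Ω_δ ∖ η`, of the `ρ`-side darts of `η`:
`Σ_{side darts (η_k + d → η_k)} G_{Ω_δ∖η}(z, η_k + d)` (last-exit decomposition: the walk is killed
through the dart `(q → q')` with probability `G(z, q)/4`). -/
def sideDartSum (Ω : Set ℂ) (δ : ℝ) {u w : Site 2} (ρ : Site 2 → Site 2)
    (η : (discreteDomainGraph Ω δ).Walk u w) (z : Site 2) : ℝ :=
  ∑ k ∈ Finset.range η.length, ∑ d ∈ dirs,
    if IsSideDart ρ η k d then SRW.killedGreen (slitGraph Ω δ (verts η)) z (η.getVert k + d) else 0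

/-- `4 ×` the harmonic measure, from `z` in `Ω_δ ∖ η`, of the exits of `Ω_δ` through the discrete
boundary arc `1` (`discreteArc`, Smirnov's closest-arc convention; `D.arc 1` runs from `b` to `a`):
`Σ_{q ∈ arc₁, q ∉ η} #{non-edges of Ω_δ at q} · G_{Ω_δ∖η}(z, q)`. -/
def arcExitSum (D : DobrushinDomain) (δ : ℝ) {u w : Site 2}
    (η : (discreteDomainGraph D.carrier δ).Walk u w) (z : Site 2) : ℝ :=
  ∑' q : Site 2,
    if q ∈ discreteArc D.carrier δ (D.arc 1) ∧ q ∉ η.support then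
      (∑ d ∈ dirs, if (discreteDomainGraph D.carrier δ).Adj q (q + d) then (0 : ℝ) else 1) *
        SRW.killedGreen (slitGraph D.carrier δ (verts η)) z q
    else 0

/-- The **lattice side angle** `θ*_δ(η, z) := π ×` harmonic measure from `z`, in `Ω_δ ∖ η`, of
[exits through `arc 1`] + [side darts of `η` on the `arc 1` side]. Which side of `η` faces
`arc 1` is decided by the ORIENTATION of the boundary loop (`JordanDomain.index = +1`:
anticlockwise, `arc 1` side = left of the direction of travel `a → b`; `−1`: right). In the limit
`θ*` is `arg z_t` or `π − arg z_t` of the centred flow, and the profile `Λ` does not distinguish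
them. -/
def sideAngle (D : DobrushinDomain) (δ : ℝ) {u w : Site 2}
    (η : (discreteDomainGraph D.carrier δ).Walk u w) (z : Site 2) (zc : ℂ) : ℝ :=
  Real.pi / 4 *
    (arcExitSum D δ η z +
      sideDartSum D.carrier δ (if D.toJordanDomain.index zc = 1 then rotL else rotR) η z)

/-- The **expected terminal room given the past**: `E_δ[G_{Ω_δ∖γ}(z,z) ∣ γ begins with η]` under
the critical SAW law from `a` to `b` (set integral over the cylinder of `η` divided by its mass;
by the domain-Markov property of `x_c^{|γ|}` this is the expected-terminal-room one-point function
of the slit domain `(Ω_δ ∖ η; tip, b)`). Junk `0/0 = 0` on cylinders of mass `0` (never met on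
pasts of sampled walks). -/
def condRoom (Ω : Set ℂ) (δ : ℝ) (a b z : Site 2) {w : Site 2}
    (η : (discreteDomainGraph Ω δ).Walk a w) : ℝ :=
  (∫ γ in {γ : SAW.DomainSAW Ω δ a b | ∃ hw : w ∈ γ.walk.support, γ.walk.takeUntil w hw = η},
      roomAt Ω δ (verts γ.walk) z ∂(SAW.law Ω δ a b)) /
    ((SAW.law Ω δ a b)
      {γ : SAW.DomainSAW Ω δ a b | ∃ hw : w ∈ γ.walk.support, γ.walk.takeUntil w hw = η}).toReal

/-! ## The four statements of the line -/

/-- STUB 1 statement — **the room–entropy law in slit domains, in probability along the past**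
(lattice crux of the line; OPEN — the bet). For every Dobrushin domain, endpoint approximation,
interior point `z` with lattice approximations `z_δ → z`, radius `r > 0` and `ε > 0`: for all
small `δ`, with `P_δ`-probability `≥ 1 − ε`, EVERY initial segment `η = γ[0,n]` of the walk whose
vertices stay at distance `≥ r` from `z` satisfies
`|E_δ[terminal room ∣ η] − room(η) + (2/π)·Λ(θ*_δ(η))| ≤ ε`,
i.e. the conditional expected room still to be lost is `(2/π)·3H(sin²(θ*_δ/2))`. The factor
`2/π` is the SRW Green-function normalisation (`G = (2/π) log(crad/δ) + k₀ + o(1)`). The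
EXPECTATION form presupposes uniform integrability of the future's logarithmic approach to `z`
(an interior one-arm bound `P_δ[dist(z, γ) ≤ ε'] ≤ C ε'^c` uniform in `δ`, believed with
`c = 2/3`): this is part of the conjecture as typed (triage r1-1), see the line card for the
bounded moment-channel sibling. -/
def RoomLawSlit : Prop :=
  ∀ (D : DobrushinDomain) (a b : ℝ → Site 2), SAW.IsEndpointApprox D a b →
    ∀ z ∈ D.carrier, ∀ (zδ : ℝ → Site 2),
      Tendsto (fun δ => meshPoint δ (zδ δ)) (𝓝[>] (0 : ℝ)) (𝓝 z) →
    ∀ r ε : ℝ, 0 < r → 0 < ε →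
    ∀ᶠ δ in 𝓝[>] (0 : ℝ),
      SAW.law D.carrier δ (a δ) (b δ)
          {γ | ∃ (w : Site 2) (hw : w ∈ γ.walk.support),
            (∀ v ∈ (γ.walk.takeUntil w hw).support, r ≤ dist (meshPoint δ v) z) ∧
            ε < |condRoom D.carrier δ (a δ) (b δ) (zδ δ) (γ.walk.takeUntil w hw)
                  - roomAt D.carrier δ (verts (γ.walk.takeUntil w hw)) (zδ δ)
                  + (2 / Real.pi) * roomProfile (sideAngle D δ (γ.walk.takeUntil w hw) (zδ δ) z)|}
        ≤ ENNReal.ofReal ε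

/-- STUB 2 conclusion — **the room–entropy martingales of a describable subsequential limit.** For
every Dobrushin domain, endpoint approximation, chordal uniformizing map `φ` and probability
subsequential limit law `μ` of the SAW curve laws carried by curve classes that are
Loewner-describable through `φ` and start at `a` (the output of `LimitsDescribable`): there is a
filtration of the curve space to which the driving process `W = drivingFunction φ` is adapted and
for which, for every `w ∈ ℍ` and level `m`, the stopped observable
`t ↦ N^{w,m}_t = [log ψ + 3H(S)]_{t ∧ τ^{w,m}}(W(c), w)` is a martingale. (Strong adaptedness of
`N^{w,m}` is PART of `Martingale`, so no measurability is assumed away; the processes are bounded.) -/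
def RoomMartingaleLimit : Prop :=
  ∀ (D : DobrushinDomain) (a b : ℝ → Site 2)
    (φ : ConformalEquiv upperHalfPlaneSet D.carrier) (μ : Measure (CurveClass ℂ)),
    SAW.IsEndpointApprox D a b → D.IsChordalUniformizing φ → IsProbabilityMeasure μ →
    IsSubseqLimitLaw (fun δ (γ : SAW.DomainSAW D.carrier δ (a δ) (b δ)) => γ.curve)
      (fun δ => SAW.law D.carrier δ (a δ) (b δ)) μ →
    (∀ᵐ c ∂μ, IsLoewnerDescribable φ c ∧ c.source = D.pt 0) →
    ∃ 𝓕 : Filtration ℝ≥0 (inferInstance : MeasurableSpace (CurveClass ℂ)),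
      Adapted 𝓕 (fun t c => drivingFunction φ c t) ∧
      ∀ w : ℂ, 0 < w.im → ∀ m : ℕ,
        Martingale (fun t c => roomObsStopped (drivingFunction φ c) w m t) 𝓕 μ

/-- STUB 3 statement — **the room–entropy martingales characterise SLE(8/3)** (continuum endgame,
provable now). If a probability law `ν` on curve classes is carried by classes Loewner-describable
through the chordal uniformizing map `φ` of `(D; a, b)` and starting at `a`, and for some
filtration to which `W = drivingFunction φ` is adapted every stopped room–entropy observable
`N^{w,m}` (`w ∈ ℍ`, `m ∈ ℕ`) is a martingale, then `ν` is the chordal SLE(8/3) law of `D`.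
Mechanism: `W(c)` is continuous with `W₀ = 0` a.e. (`drivingFunction_apply_zero`, from
`source = a`); for `w = R e^{iθ₀}` and the stopping time `σ_K = inf{|W| ≥ K}` the pathwise far
field of the Loewner flow (`LoewnerFarField`) gives, uniformly on `[0, σ_K ∧ T]`,
`N_t − N_0 = Λ'(θ₀) sin θ₀ · W_t/R + O(R⁻²)` (so `W^{σ_K}` is a martingale: `Λ'(π/4) sin(π/4) ≈ 1.32 ≠ 0`)
and at `θ₀ = π/2` (`Λ'(π/2) = 0`, `Λ''(π/2) = −3`, room term `log ψ_t = 4t/R² + O(R⁻³)`)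
`N_t − N_0 = (−(3/2) W_t² + 4t)/R² + O(R⁻³)` (so `(W² − (8/3)t)^{σ_K}` is a martingale); hence
`W/√(8/3)` is a continuous local martingale with quadratic variation `t`, and
`isSLELaw_of_isLocalMartingale_driving_of_lt_four` (PROVED; `0 < 8/3 < 4`) concludes, the
describability hypothesis supplying `Loewner.IsDrivenBy` (`isLoewnerDescribed_iff_isDrivenBy`). -/
def RoomEntropyCharacterisesSLE : Prop :=
  ∀ (D : DobrushinDomain) (φ : ConformalEquiv upperHalfPlaneSet D.carrier)
    (ν : Measure (CurveClass ℂ)),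
    D.IsChordalUniformizing φ → IsProbabilityMeasure ν →
    (∀ᵐ c ∂ν, IsLoewnerDescribable φ c ∧ c.source = D.pt 0) →
    ∀ 𝓕 : Filtration ℝ≥0 (inferInstance : MeasurableSpace (CurveClass ℂ)),
      Adapted 𝓕 (fun t c => drivingFunction φ c t) →
      (∀ w : ℂ, 0 < w.im → ∀ m : ℕ,
        Martingale (fun t c => roomObsStopped (drivingFunction φ c) w m t) 𝓕 ν) →
    IsSLELaw ((8 : ℝ≥0) / 3) D ν

/-! ## Non-vacuity checks (provable now; NOT stubs, not used by the composition) -/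

/-- (F3a of the card) The room profile solves the κ = 8/3 Feynman–Kac ODE on `(0, π)`:
`sin θ · Λ'' − cos θ · Λ' = −3 sin θ` (i.e. `(κ/2) sin θ Λ'' + (κ − 4) cos θ Λ' = −4 sin θ`);
with `Λ(0) = Λ(π) = 0` this pins `Λ` uniquely (homogeneous solutions `C₁ + C₂ cos θ`). -/
def RoomProfileODE : Prop :=
  ∀ θ ∈ Ioo (0 : ℝ) Real.pi,
    Real.sin θ * deriv (deriv roomProfile) θ - Real.cos θ * deriv roomProfile θ = -3 * Real.sin θ

/-- (F3b of the card) The Itô drift of `N = log ψ + 3H(S)` along the chordal Loewner flow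
`dz_t = (2/z_t) dt − dW_t`, `W = √κ B`, vanishes identically at `κ = 8/3`: with
`F(u, v) = 3H((1 + u/√(u²+v²))/2)` (= `3H(S)` at `z_t = u + iv`) and `d log ψ = 4v²/(u²+v²)² dt`,
`(4/3) F_uu + (2u/(u²+v²)) F_u − (2v/(u²+v²)) F_v = −4v²/(u²+v²)²` for `v > 0`.
(For general κ the left side with `κ/2` in place of `4/3` misses the right side by a nonzero
multiple of `3κ − 8`: the observable singles out κ = 8/3.) -/
def RoomEntropyDrift : Prop :=
  let F : ℝ → ℝ → ℝ := fun u v => 3 * Real.binEntropy ((1 + u / Real.sqrt (u ^ 2 + v ^ 2)) / 2)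
  ∀ u v : ℝ, 0 < v →
    (4 / 3 : ℝ) * deriv (fun x => deriv (fun y => F y v) x) u
        + (2 * u / (u ^ 2 + v ^ 2)) * deriv (fun y => F y v) u
        - (2 * v / (u ^ 2 + v ^ 2)) * deriv (fun y => F u y) v
      = -(4 * v ^ 2 / (u ^ 2 + v ^ 2) ^ 2)

/-! ## Stubs (registered; `sorry` only here) -/

/-- STUB 1 (OPEN — the line's bet; hardest). The room–entropy law of the critical `ℤ²` SAW in slit
domains, in probability along the past. Why plausibly true: it is the κ = 8/3 member of a
one-parameter family of expected-room profiles whose κ = 2 member is an EXACT finite-graph identity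
for the loop-erased walk (Lawler's determinant formula; verified in exact arithmetic on the 4×4 box
by the ideator) and whose κ = 4 member is the GFF level-line variance identity; it is implied by
the conjunct together with the interior one-arm bound; it is orientation-free as the SAW is.
No lattice mechanism is known (honest residue of the card): candidate habitats are the
monotone couplings in the domain (more past, less room) for one-sided bounds and the BFS–Dynkin /
supersymmetric isomorphism, where "Green function with the walk removed" is native. Cheapest
falsifier: the strip transfer-matrix test F1/F2 of the card (centre value `(6/π) log 2 = 1.3238`,
shape `H(sin²)` vs LERW's `sin²`). Leans on: `SRW.killedGreen` + first-step/symmetry API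
(`SRWKilledWalkFunctionals`), `SAW.law`, `discreteArc`, `JordanDomain.index`. -/
theorem stub_roomLawSlit :
    ∀ (D : DobrushinDomain) (a b : ℝ → Site 2), SAW.IsEndpointApprox D a b →
      ∀ z ∈ D.carrier, ∀ (zδ : ℝ → Site 2),
        Tendsto (fun δ => meshPoint δ (zδ δ)) (𝓝[>] (0 : ℝ)) (𝓝 z) →
      ∀ r ε : ℝ, 0 < r → 0 < ε →
      ∀ᶠ δ in 𝓝[>] (0 : ℝ),
        SAW.law D.carrier δ (a δ) (b δ)
            {γ | ∃ (w : Site 2) (hw : w ∈ γ.walk.support),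
              (∀ v ∈ (γ.walk.takeUntil w hw).support, r ≤ dist (meshPoint δ v) z) ∧
              ε < |condRoom D.carrier δ (a δ) (b δ) (zδ δ) (γ.walk.takeUntil w hw)
                    - roomAt D.carrier δ (verts (γ.walk.takeUntil w hw)) (zδ δ)
                    + (2 / Real.pi) * roomProfile (sideAngle D δ (γ.walk.takeUntil w hw) (zδ δ) z)|}
          ≤ ENNReal.ofReal ε := by
  sorry

/-- STUB 2 (XL; known technology, three layers — see the module docstring). From the lattice law to
the martingale property of the stopped continuum observables under any describable subsequential
limit. Leans on: `measurable_drivingFunction_apply`, `isLoewnerDescribed_drivingFunction`,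
`IsLoewnerDescribed.exists_eq_mk_trace`, `Loewner.derivRatio_eq_exp`, `one_le_derivRatio`,
`schrammObs_mem_Icc`, `im_centredMap_pos`, the Skorokhod/portmanteau API of
`SLEConvergenceCriterion`, `Process.isStoppingTime_hittingAfter_of_continuous`
(`ContinuousHitting`), Disproof §3 `ae_endpoints_of_hyps` / `ae_range_subset_closure_of_hyps`;
in print: Kozdron–Lawler 2005 (arXiv:math/0501189) §2.3, §3 and Lawler–Limic 2010 §4.4, §6.2–6.3
(Green-function asymptotics in simply connected lattice domains, uniform in the inradius),
LSW04 (arXiv:math/0112234) §2 and §3.3–3.4, Kemppainen–Smirnov 2017 Thm 1.5 (iii) / Cor 1.7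
(capacity parametrisation and driving terms along the coupling). Risk: the describability input
is typed in OUTPUT form (ii) of KS17 Thm 1.5, as in `SAWLaplacianWalk.HarmonicPassage`; should
layer (ii) need KS's convergence (iii) as an input rather than re-deriving it on the describable
support, strengthen the hypothesis to the Condition-G2 item (stmt-CriticalPhenomena-0792 /
`KSAdmissibleG1` stmt-11346) — same open input class. -/
theorem stub_roomMartingaleLimit :
    (∀ (D : DobrushinDomain) (a b : ℝ → Site 2), SAW.IsEndpointApprox D a b →
        ∀ z ∈ D.carrier, ∀ (zδ : ℝ → Site 2),
          Tendsto (fun δ => meshPoint δ (zδ δ)) (𝓝[>] (0 : ℝ)) (𝓝 z) →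
        ∀ r ε : ℝ, 0 < r → 0 < ε →
        ∀ᶠ δ in 𝓝[>] (0 : ℝ),
          SAW.law D.carrier δ (a δ) (b δ)
              {γ | ∃ (w : Site 2) (hw : w ∈ γ.walk.support),
                (∀ v ∈ (γ.walk.takeUntil w hw).support, r ≤ dist (meshPoint δ v) z) ∧
                ε < |condRoom D.carrier δ (a δ) (b δ) (zδ δ) (γ.walk.takeUntil w hw)
                      - roomAt D.carrier δ (verts (γ.walk.takeUntil w hw)) (zδ δ)
                      + (2 / Real.pi) * roomProfile (sideAngle D δ (γ.walk.takeUntil w hw) (zδ δ) z)|}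
            ≤ ENNReal.ofReal ε) →
    ∀ (D : DobrushinDomain) (a b : ℝ → Site 2)
      (φ : ConformalEquiv upperHalfPlaneSet D.carrier) (μ : Measure (CurveClass ℂ)),
      SAW.IsEndpointApprox D a b → D.IsChordalUniformizing φ → IsProbabilityMeasure μ →
      IsSubseqLimitLaw (fun δ (γ : SAW.DomainSAW D.carrier δ (a δ) (b δ)) => γ.curve)
        (fun δ => SAW.law D.carrier δ (a δ) (b δ)) μ →
      (∀ᵐ c ∂μ, IsLoewnerDescribable φ c ∧ c.source = D.pt 0) →
      ∃ 𝓕 : Filtration ℝ≥0 (inferInstance : MeasurableSpace (CurveClass ℂ)),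
        Adapted 𝓕 (fun t c => drivingFunction φ c t) ∧
        ∀ w : ℂ, 0 < w.im → ∀ m : ℕ,
          Martingale (fun t c => roomObsStopped (drivingFunction φ c) w m t) 𝓕 μ := by
  sorry

/-- STUB 3 (L; provable now with tree technology). The room–entropy martingales characterise
SLE(8/3). Leans on: `LoewnerFarField` (pathwise far-field expansion of `g_t`, as consumed by
`Loewner.martingale_driver_of_fkObservable`), `Process.ContinuousOptionalSampling`
(`Martingale.isAEMartingale_stoppedProcess`), `Process.isStoppingTime_hittingAfter_of_continuous`,
`IsLocalMartingale`, `Process.HasQuadraticVariation`, `isSLELaw_of_isLocalMartingale_driving_of_lt_four`,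
`continuous_drivingFunction`, `drivingFunction_apply_zero` / `ae_drivingFunction_apply_zero`,
`isLoewnerDescribed_iff_isDrivenBy`, `measurable_drivingFunction_apply`, Mathlib
`Real.binEntropy`, `Real.deriv_binEntropy` (values `Λ'(π/2) = 0`, `Λ''(π/2) = −3`,
`Λ'(π/4) ≠ 0`), `Loewner.derivRatio_eq_exp` (`log ψ_t = ∫ 4y²/|z|⁴`). -/
theorem stub_roomEntropyCharacterisesSLE :
    ∀ (D : DobrushinDomain) (φ : ConformalEquiv upperHalfPlaneSet D.carrier)
      (ν : Measure (CurveClass ℂ)),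
      D.IsChordalUniformizing φ → IsProbabilityMeasure ν →
      (∀ᵐ c ∂ν, IsLoewnerDescribable φ c ∧ c.source = D.pt 0) →
      ∀ 𝓕 : Filtration ℝ≥0 (inferInstance : MeasurableSpace (CurveClass ℂ)),
        Adapted 𝓕 (fun t c => drivingFunction φ c t) →
        (∀ w : ℂ, 0 < w.im → ∀ m : ℕ,
          Martingale (fun t c => roomObsStopped (drivingFunction φ c) w m t) 𝓕 ν) →
      IsSLELaw ((8 : ℝ≥0) / 3) D ν := by
  sorry

/-! ## Consistency: each named statement IS its registered stub (definitionally)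

The stubs above are registered with their signatures SPELLED OUT over the line vocabulary (so that
the stub files under `Theorems/`, which import `Theorems/SAWRenewalTightnessRoomEntropyDefs.lean`,
state the identical text); the named statements are recovered by `Iff.rfl`-level coercion. -/

theorem roomLawSlit_holds : RoomLawSlit := stub_roomLawSlit
theorem roomMartingaleLimit_holds : RoomLawSlit → RoomMartingaleLimit := stub_roomMartingaleLimit
theorem roomEntropyCharacterisesSLE_holds : RoomEntropyCharacterisesSLE :=
  stub_roomEntropyCharacterisesSLE

/-! ## Composition (sorry-free): the stubs and the shared item `LimitsDescribable` prove the crux BY NAME -/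

/-- The SHAPE of the line as one proposition. -/
def LineShape : Prop :=
  RoomLawSlit → (RoomLawSlit → RoomMartingaleLimit) → RoomEntropyCharacterisesSLE →
    LimitsDescribable → SubseqIdentification

/-- **The kernel-checked composition** (pure logic plus the PROVED existence of a chordal
uniformizing map, `MarkedDomain.exists_isChordalUniformizing_holds`): the crux hypotheses say
exactly that `μ` is a probability subsequential limit law of the SAW curve laws
(`IsSubseqLimitLaw`, witnessed by the given `s`); `LimitsDescribable` makes `μ`-a.e. class
describable from `a`; stub 2 (fed by stub 1) produces the filtration and the martingales; stub 3
identifies `μ`. -/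
theorem lineShape_holds : LineShape := by
  intro hL hP hI hR D a b hab s μ hs hμ hlim
  have hsub : IsSubseqLimitLaw (fun δ (γ : SAW.DomainSAW D.carrier δ (a δ) (b δ)) => γ.curve)
      (fun δ => SAW.law D.carrier δ (a δ) (b δ)) μ := ⟨s, hs, hlim⟩
  obtain ⟨φ, hφ⟩ := MarkedDomain.exists_isChordalUniformizing_holds D
  have hdesc := hR D a b hab φ hφ μ hμ hsub
  obtain ⟨𝓕, hW, hN⟩ := hP hL D a b φ μ hab hφ hμ hsub hdesc
  exact hI D φ μ hφ hμ hdesc 𝓕 hW hN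

/-- **`SubseqIdentification` from the three registered stubs and the shared route item
`SAWLaplacianWalk.LimitsDescribable` (stmt-CriticalPhenomena-4481, taken BY NAME as a hypothesis)**
— the skeleton theorem audited by `#h21_check_skeleton`: concludes the route decl
`SAWRenewalTightness.SubseqIdentification` BY NAME; `sorry` enters only through `stub_*`. -/
theorem SubseqIdentification_of (hR : LimitsDescribable) : SubseqIdentification :=
  lineShape_holds stub_roomLawSlit stub_roomMartingaleLimit stub_roomEntropyCharacterisesSLE hR

/-- The same skeleton theorem for the decl of the FIRST route wanting the shared crux
(`SAWParafermion.SubseqIdentification`, identical statement text — the decl that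
`ledger skeleton check` resolves by default); `SAWLeftRightFKG` / `SAWAsymptoticMorera` likewise. -/
theorem SubseqIdentification_of'
    (hR : LimitsDescribable) :
    Summit.CriticalPhenomena.SAWScalingLimit.Theses.SAWParafermion.SubseqIdentification :=
  SubseqIdentification_of hR

end Summit.CriticalPhenomena.SAWScalingLimit.Cruxes.SubseqIdentification.RoomEntropyWrightFisher

end
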